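import Mathlib
import Summits.Ventures.PercRepro.TriangleCapTriangleFreeFourA

/-!
# PercRepro — FOUR BELOW THE DIAGONAL ON THE TRIANGLE-FREE CLASS, PART B: THE ROW BOUNDS AND THE ARITHMETIC
(p3, gen 39; part 118)

The generic row-sum bounds used by the count at an edge of deficit one (part C): a row with a distinguished
neighbour `w` (`row_ge_special`), a row with a uniform bound and a bonus on a class `S` (`row_ge_two_classes`),
a row whose neighbourhood is a disjoint union of two classes (`row_ge_union`), the symmetry of the deficit, the
degree sums `Σ d = Σ (d − 1) + |S|`, the double count `Σ_{y ∈ Y} |N(y) ∩ X| = Σ_{x ∈ X} (d(x) − 1)` when every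
`x ∈ X` has `N(x) = {w} ∪ (N(x) ∩ Y)`, and the arithmetic `deficit_one_arith`.  Axioms: standard.
-/

namespace PercRepro

namespace TriangleCap

namespace C047

open Finset

variable {V : Type*} [Fintype V] [DecidableEq V]

omit [Fintype V] [DecidableEq V] in
/-- The arithmetic of the edge-of-deficit-one count: `1 ≤ t < α`, `1 ≤ s < β`, `e₁ ≥ t`, `e₂ ≥ s` ⇒
`2 (α + β − 4) ≤ 2 t (α − t − 1) + 2 s (β − s − 1) + 2 (s − 1) e₁ + 2 (t − 1) e₂`. -/
theorem deficit_one_arith (t s α β e₁ e₂ : ℕ) (ht : 1 ≤ t) (htα : t + 1 ≤ α) (hs : 1 ≤ s) (hsβ : s + 1 ≤ β)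
    (he₁ : t ≤ e₁) (he₂ : s ≤ e₂) :
    2 * (α + β - 4) ≤ 2 * (t * (α - t - 1)) + 2 * (s * (β - s - 1)) + 2 * ((s - 1) * e₁) + 2 * ((t - 1) * e₂) := by
  obtain ⟨t', rfl⟩ : ∃ t', t = t' + 1 := ⟨t - 1, by omega⟩
  obtain ⟨s', rfl⟩ : ∃ s', s = s' + 1 := ⟨s - 1, by omega⟩
  obtain ⟨a, rfl⟩ : ∃ a, α = t' + 1 + 1 + a := ⟨α - t' - 2, by omega⟩
  obtain ⟨b, rfl⟩ : ∃ b, β = s' + 1 + 1 + b := ⟨β - s' - 2, by omega⟩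
  obtain ⟨f₁, rfl⟩ : ∃ f₁, e₁ = t' + 1 + f₁ := ⟨e₁ - t' - 1, by omega⟩
  obtain ⟨f₂, rfl⟩ : ∃ f₂, e₂ = s' + 1 + f₂ := ⟨e₂ - s' - 1, by omega⟩
  have e1 : t' + 1 + 1 + a - (t' + 1) - 1 = a := by omega
  have e2 : s' + 1 + 1 + b - (s' + 1) - 1 = b := by omega
  have e3 : s' + 1 - 1 = s' := by omega
  have e4 : t' + 1 - 1 = t' := by omega
  have e5 : t' + 1 + 1 + a + (s' + 1 + 1 + b) - 4 = t' + a + s' + b := by omega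
  rw [e1, e2, e3, e4, e5]
  nlinarith

omit [DecidableEq V] in
/-- The deficit is symmetric in the pair. -/
theorem deficit_symm (D : SimpleGraph V) [DecidableRel D.Adj] (x y : V) :
    deficit D (x, y) = deficit D (y, x) := by
  unfold deficit
  congr 1
  ext z
  simp only [mem_filter, mem_univ, true_and]
  tauto

/-- A row with a distinguished neighbour `w`: `c₀ ≤ deficit (x, w)` and `c ≤ deficit (x, y)` on the other
neighbours give `c₀ + c (d(x) − 1) ≤ Σ_{y ~ x} deficit (x, y)`. -/
theorem row_ge_special (D : SimpleGraph V) [DecidableRel D.Adj] {x w : V} (hxw : D.Adj x w) (c₀ c : ℕ)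
    (h₀ : c₀ ≤ deficit D (x, w)) (hc : ∀ y, D.Adj x y → y ≠ w → c ≤ deficit D (x, y)) :
    c₀ + c * (deg D x - 1) ≤ ∑ y ∈ univ.filter (fun y => D.Adj x y), deficit D (x, y) := by
  have hwmem : w ∈ univ.filter (fun y => D.Adj x y) := mem_filter.mpr ⟨mem_univ w, hxw⟩
  rw [← add_sum_erase _ _ hwmem]
  have h2 : ∑ y ∈ (univ.filter (fun y => D.Adj x y)).erase w, c ≤
      ∑ y ∈ (univ.filter (fun y => D.Adj x y)).erase w, deficit D (x, y) := by
    apply sum_le_sum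
    intro y hy
    rw [mem_erase, mem_filter] at hy
    exact hc y hy.2.2 hy.1
  rw [sum_const, smul_eq_mul, card_erase_of_mem hwmem] at h2
  unfold deg
  rw [mul_comm] at h2
  omega

/-- A row with the uniform bound `1` and a bonus `c` on the class `S`:
`d(x) + c |N(x) ∩ S| ≤ Σ_{y ~ x} deficit (x, y)`. -/
theorem row_ge_two_classes (D : SimpleGraph V) [DecidableRel D.Adj] (x : V) (S : Finset V) (c : ℕ)
    (h : ∀ y, D.Adj x y → 1 + (if y ∈ S then c else 0) ≤ deficit D (x, y)) :
    deg D x + c * (S.filter (fun y => D.Adj x y)).card ≤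
      ∑ y ∈ univ.filter (fun y => D.Adj x y), deficit D (x, y) := by
  have hpt : ∀ y ∈ univ.filter (fun y => D.Adj x y), 1 + (if y ∈ S then c else 0) ≤ deficit D (x, y) := by
    intro y hy
    exact h y (mem_filter.mp hy).2
  have hsum := sum_le_sum hpt
  rw [sum_add_distrib, sum_const, smul_eq_mul, mul_one, sum_ite_mem, sum_const, smul_eq_mul] at hsum
  have hcard : (univ.filter (fun y => D.Adj x y) ∩ S).card = (S.filter (fun y => D.Adj x y)).card := by
    congr 1
    ext y
    simp only [mem_inter, mem_filter, mem_univ, true_and]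
    tauto
  rw [hcard] at hsum
  unfold deg
  rw [mul_comm]
  exact hsum

/-- A row whose neighbourhood is the disjoint union `S₁ ∪ S₂`, with `c₁ ≤ deficit` on `S₁` and `c₂` on `S₂`. -/
theorem row_ge_union (D : SimpleGraph V) [DecidableRel D.Adj] (x : V) (S₁ S₂ : Finset V) (c₁ c₂ : ℕ)
    (hN : univ.filter (fun y => D.Adj x y) = S₁ ∪ S₂) (hd : Disjoint S₁ S₂)
    (h₁ : ∀ y ∈ S₁, c₁ ≤ deficit D (x, y)) (h₂ : ∀ y ∈ S₂, c₂ ≤ deficit D (x, y)) :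
    S₁.card * c₁ + S₂.card * c₂ ≤ ∑ y ∈ univ.filter (fun y => D.Adj x y), deficit D (x, y) := by
  rw [hN, sum_union hd]
  have h1 : ∑ y ∈ S₁, c₁ ≤ ∑ y ∈ S₁, deficit D (x, y) := sum_le_sum h₁
  have h2 : ∑ y ∈ S₂, c₂ ≤ ∑ y ∈ S₂, deficit D (x, y) := sum_le_sum h₂
  rw [sum_const, smul_eq_mul] at h1 h2
  omega

omit [DecidableEq V] in
/-- `Σ_{x ∈ S} d(x) = Σ_{x ∈ S} (d(x) − 1) + |S|` when every degree is positive. -/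
theorem sum_deg_eq_sum_pred_add (D : SimpleGraph V) [DecidableRel D.Adj] (S : Finset V)
    (hdeg : ∀ z, 1 ≤ deg D z) : ∑ x ∈ S, deg D x = ∑ x ∈ S, (deg D x - 1) + S.card := by
  rw [card_eq_sum_ones, ← sum_add_distrib]
  apply sum_congr rfl
  intro x _
  have := hdeg x
  omega

omit [DecidableEq V] in
/-- `|S| ≤ Σ_{x ∈ S} (d(x) − 1)` when every degree is at least `2`. -/
theorem card_le_sum_pred (D : SimpleGraph V) [DecidableRel D.Adj] (S : Finset V) (hdeg : ∀ z, 2 ≤ deg D z) :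
    S.card ≤ ∑ x ∈ S, (deg D x - 1) := by
  calc S.card = ∑ _x ∈ S, 1 := by rw [sum_const, smul_eq_mul, mul_one]
    _ ≤ ∑ x ∈ S, (deg D x - 1) := sum_le_sum (fun x _ => by have := hdeg x; omega)

/-- The double count: if every `x ∈ X` has `N(x) = {w} ∪ (N(x) ∩ Y)` with `w ∉ Y`, then
`Σ_{y ∈ Y} |N(y) ∩ X| = Σ_{x ∈ X} (d(x) − 1)`. -/
theorem sum_card_filter_eq_sum_pred (D : SimpleGraph V) [DecidableRel D.Adj] (X Y : Finset V) (w : V)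
    (hwY : w ∉ Y) (hw : ∀ x ∈ X, D.Adj x w) (hN : ∀ x ∈ X, ∀ y, D.Adj x y → y = w ∨ y ∈ Y) :
    ∑ y ∈ Y, (X.filter (fun x => D.Adj y x)).card = ∑ x ∈ X, (deg D x - 1) := by
  have h := sum_card_filter_adj_comm D X Y
  have e : ∀ x ∈ X, (Y.filter (fun y => D.Adj x y)).card = deg D x - 1 := by
    intro x hx
    have hwmem : w ∈ univ.filter (fun y => D.Adj x y) := mem_filter.mpr ⟨mem_univ w, hw x hx⟩
    have heq : Y.filter (fun y => D.Adj x y) = (univ.filter (fun y => D.Adj x y)).erase w := by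
      ext y
      rw [mem_filter, mem_erase, mem_filter]
      constructor
      · rintro ⟨hy, hxy⟩
        exact ⟨fun h => hwY (h ▸ hy), mem_univ y, hxy⟩
      · rintro ⟨hyw, -, hxy⟩
        rcases hN x hx y hxy with h | h
        · exact absurd h hyw
        · exact ⟨h, hxy⟩
    rw [heq, card_erase_of_mem hwmem]
    rfl
  have hsym : ∑ y ∈ Y, (X.filter (fun x => D.Adj y x)).card = ∑ y ∈ Y, (X.filter (fun x => D.Adj x y)).card := by
    apply sum_congr rfl
    intro y _
    congr 1
    ext x
    simp only [mem_filter]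
    constructor
    · rintro ⟨hx, hxy⟩; exact ⟨hx, hxy.symm⟩
    · rintro ⟨hx, hxy⟩; exact ⟨hx, hxy.symm⟩
  rw [hsym, ← h, sum_congr rfl e]

end C047

end TriangleCap

end PercRepro
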